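import Summits.ValiantsHypothesis.ValiantsHypothesis.Theorems.BarrierLeverPartitionMinorsHitByVPFrobeniusDoor
import Summits.ValiantsHypothesis.ValiantsHypothesis.Theorems.BarrierLeverPartitionMinorsHitByVPFrobeniusDoorCharP
import Summits.ValiantsHypothesis.ValiantsHypothesis.Theorems.BarrierLeverPartitionMinorsHitByVPBallUniversal
import HarnessLib.Audit

/-!
# Route BarrierLever — item `PartitionMinorsHitByVP` (stmt-ValiantsHypothesis-19717):
# CONJECTURE F2 («the Moore table is universal for Hamming-ball rows»), typed Theorems-side, with its
# arrows to T1 and to the BALL classes, and its base case `e ≤ 1`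

Helper file (`--supports stmt-ValiantsHypothesis-19717`; cell valiant-natproofs, rung V4, 𝒟-side door (c),
prover seat val-np-p6 gen 5). Closes NO item. ONE Theorems-side predicate (`MooreBallNonsingular`, the cell's
conjecture F2 for one pair `(h, e)`; NO assertion), per director-valiant's standing rule «killable conjectures =
Theorems-side def + arrow + falsifier, never items»; the falsifier is kit job j281989 (char-2 determinants
over GF(2^64), exhaustive at `h ≤ 5`, sampled to `h = 10`).

Through the symbolic Frobenius door (`FrobeniusDoor.exists_table_of_frobenius`, this seat) conjecture T1 of
`…BallUniversal` (val-np-p6 g4: «every layout whose rows are the full Hamming ball `B([h], e)` admits a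
nonsingular additive table») follows from a statement about ONE explicit table over `𝔽₂[Y₀,…,Y_h]`:

* `MooreBallNonsingular h e` — **F2(h,e)**: for every layout whose rows run through the ball `B([h], e)` and
  every injective column family `w`, `det [η_{u i}^{bin (w j)}]_{i,j} ≠ 0` in `𝔽₂[Y]`,
  `η_U = Y_none + Σ_{a∈U} Y_(some a)`, `bin W = Σ_{c∈W} 2^c` (a generalized Vandermonde whose nodes are the
  partial sums of `≤ e` of the indeterminates `Y_(some a)`, shifted by `Y_none`).
* **`ballRowsUniversal_of_moore`** — F2(h,e) ⇒ T1(h,e) verbatim (the `hyp` of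
  `AdditiveDoor.partitionMinor_hit_ballRows_of_universal`).
* **`partitionMinor_hit_ballRows_of_moore`**, **`partitionMinor_hit_ballColumns_of_moore`** — F2(h,e) ⇒ the layout
  classes «ball rows × ANY columns» and «ANY rows × ball columns» of item 19717 (`r = C(h, ≤ e)`, exponential in `h`
  for `e = ⌊h/2⌋`), in `SmallCircuits ℂ (h+h) 5`, `h ≥ 2`.
* `det_X_pow_ne_zero` — a generalized Vandermonde in DISTINCT INDETERMINATES with distinct exponents is nonzero
  over any nontrivial commutative ring (the coefficient of `∏ X_i^{m i}` is `1`); hence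
  **`mooreBallNonsingular_of_le_one`** — F2(h,e) HOLDS for `e ≤ 1` (the nodes `Y_none`, `Y_none + Y_(some a)` are
  an invertible linear image of indeterminates), a third proof of T1(h,1) (`…BallUniversalOne`).

EVIDENCE AND STATUS (updated 2026-08-27T15:40Z, same seat, after kit j281989 finished; exact arithmetic in GF(2^64), three
independent random tables; a layout is certified when the determinant is nonzero at one point — which PROVES the
polynomial nonzero): **F2 is FALSE at `(h,e) = (5,2)`** — 358 of the 601 080 390 column families (EXHAUSTIVE) have an
identically vanishing characteristic-2 determinant (first witness: binary weights `{8,…,21, 24, 25}`; after the common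
factor `η^8` the exponents are `{0,…,13,16,17}` and the Schur factor `s_{(2,2)} = h_2^2 − h_1 h_3` vanishes on the
sixteen ball nodes modulo 2 — a shadow of `p_{2k} = p_k^2`); all twenty printed witnesses are certified by the same
table in characteristic `3`, `5` and `7` (door `…FrobeniusDoorCharP`, this seat), and the layouts themselves are hit
(val-np-p6 g4's integer table, kit j279751, exhaustive at `(5,2)`), so T1 is untouched. F2 HOLDS exhaustively at
`h = 3, 4` (every `e`), at `(5,1)`, `(5,3)` (all 906 192 families), `(5,4)`, `(6,5)`, and on 5.9·10⁶ random and
complement-closed families at `h = 6,…,10` (`e = 2,3,4`): 0 further failures. So `MooreBallNonsingular h e` is a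
predicate that is TRUE for `e ≤ 1` (proved below), FALSE for `(5,2)`, numerically true at `(5,3)`, and open in
general; the live conjecture is F_* of `…FrobeniusDoorCharP` / `MooreBallNonsingularChar` below («for every ball
layout SOME prime works»). WHY THE FROBENIUS TABLES MATTER: (i) every characteristic-`p` specialization used so far
(code polynomials `Y_(some a) ↦ t^a`: engine v3, binary/block-contiguous classes) factors through them; (ii) the only
competing certificate scheme for T1 — leading terms after fixing single table columns to special affine functions,
base case affinely independent rows — provably cannot reach complement-closed column families at `(h,e) = (5,3)`
(every form has degree 13 = N/2 and `B([5],3)` has no 13-point flat), while the characteristic-2 table certifies all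
of `(5,3)`.

WHAT THIS IS NOT: F2 and T1 are OPEN for `e ≥ 2`; the `e ≤ 1` case and all classes here are inside the sparse regime
only when `e` is bounded — the exponential content is conditional; nothing on CPM (20172/20195), crux 14610 or VP vs VNP.
-/

set_option linter.dupNamespace false

namespace Summit.ValiantsHypothesis.ValiantsHypothesis.Theorems.BarrierLever.FrobeniusDoor

open Finset MvPolynomial Matrix
open Literature.Barriers.ValiantsHypothesis

noncomputable section

variable {h : ℕ}

/-! ## 1. Conjecture F2, typed -/

/-- **Conjecture F2(h, e)** («the Moore table is universal for Hamming-ball rows»; killable, falsifier kit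
j281989): whenever the rows `u i` run through every subset of `Fin h` of size `≤ e` exactly once and the columns
`w` are injective, the generalized Vandermonde `[η_{u i}^{bin (w j)}]`, `η_U = Y_none + Σ_{a∈U} Y_(some a)`, has
nonzero determinant in `𝔽₂[Y]`. NOT asserted. -/
@[conjecture] def MooreBallNonsingular (h e : ℕ) : Prop :=
  ∀ (r : ℕ) (u w : Fin r → Finset (Fin h)), Function.Injective u → Function.Injective w →
    (∀ i, (u i).card ≤ e) → (∀ S : Finset (Fin h), S.card ≤ e → ∃ i, u i = S) →
    (Matrix.of fun i j : Fin r =>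
      ((X none + ∑ a ∈ u i, X (some a) : MvPolynomial (Option (Fin h)) (ZMod 2))) ^
        (∑ c ∈ w j, 2 ^ (c : ℕ))).det ≠ 0

/-! ## 2. Arrows: F2 ⇒ T1 ⇒ the ball classes of item 19717 -/

/-- **F2(h,e) ⇒ T1(h,e)**: the Moore conjecture gives, for every ball-row layout, a numeric complex additive
table with nonzero determinant — verbatim the hypothesis `hyp` of `…BallUniversal`. -/
theorem ballRowsUniversal_of_moore {e : ℕ} (hF : MooreBallNonsingular h e)
    (r : ℕ) (u w : Fin r → Finset (Fin h)) (hu : Function.Injective u) (hw : Function.Injective w)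
    (hsmall : ∀ i, (u i).card ≤ e) (hall : ∀ S : Finset (Fin h), S.card ≤ e → ∃ i, u i = S) :
    ∃ (ω₀ : Fin h → ℂ) (ω : Fin h → Fin h → ℂ),
      (Matrix.of fun i j : Fin r => ∏ c ∈ w j, (ω₀ c + ∑ a ∈ u i, ω a c)).det ≠ 0 :=
  exists_table_of_frobenius u w (hF r u w hu hw hsmall hall)

/-- **F2(h,e) ⇒ «BALL ROWS × ANY COLUMNS»**: `h ≥ 2`; rows = the Hamming ball `B([h], e)` (each subset of size
`≤ e` exactly once), columns ANY injective family; hit inside `SmallCircuits ℂ (h+h) 5`. -/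
theorem partitionMinor_hit_ballRows_of_moore {e : ℕ} (hh : 2 ≤ h) (hF : MooreBallNonsingular h e)
    {r : ℕ} (u w : Fin r → Finset (Fin h)) (hu : Function.Injective u) (hw : Function.Injective w)
    (hsmall : ∀ i, (u i).card ≤ e) (hall : ∀ S : Finset (Fin h), S.card ≤ e → ∃ i, u i = S) :
    ∃ f ∈ SmallCircuits ℂ (h + h) 5,
      (Matrix.of fun i j : Fin r => MvPolynomial.coeff
        (∑ a ∈ u i, Finsupp.single (Fin.castAdd h a) 1 +
          ∑ c ∈ w j, Finsupp.single (Fin.natAdd h c) 1) f).det ≠ 0 :=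
  AdditiveDoor.partitionMinor_hit_ballRows_of_universal h e hh
    (fun r u w hu hw hs ha => ballRowsUniversal_of_moore hF r u w hu hw hs ha) u w hu hw hsmall hall

/-- **F2(h,e) ⇒ «ANY ROWS × BALL COLUMNS»** (the mirror class; `r = C(h, ≤ e)`). -/
theorem partitionMinor_hit_ballColumns_of_moore {e : ℕ} (hh : 2 ≤ h) (hF : MooreBallNonsingular h e)
    {r : ℕ} (u w : Fin r → Finset (Fin h)) (hu : Function.Injective u) (hw : Function.Injective w)
    (hsmall : ∀ j, (w j).card ≤ e) (hall : ∀ S : Finset (Fin h), S.card ≤ e → ∃ j, w j = S) :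
    ∃ f ∈ SmallCircuits ℂ (h + h) 5,
      (Matrix.of fun i j : Fin r => MvPolynomial.coeff
        (∑ a ∈ u i, Finsupp.single (Fin.castAdd h a) 1 +
          ∑ c ∈ w j, Finsupp.single (Fin.natAdd h c) 1) f).det ≠ 0 :=
  AdditiveDoor.partitionMinor_hit_ballColumns_of_universal h e hh
    (fun r u w hu hw hs ha => ballRowsUniversal_of_moore hF r u w hu hw hs ha) u w hu hw hsmall hall

/-! ## 3. Generalized Vandermonde in distinct indeterminates -/

/-- The product `∏_i X_(σ i)^(m i)` is the monomial with exponent `Σ_i single (σ i) (m i)`. -/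
theorem prod_X_pow_eq_monomial' {R : Type*} [CommSemiring R] {r : ℕ} (σ : Equiv.Perm (Fin r))
    (m : Fin r → ℕ) :
    (∏ i : Fin r, (X (σ i) : MvPolynomial (Fin r) R) ^ m i) =
      monomial (∑ i : Fin r, Finsupp.single (σ i) (m i)) 1 := by
  rw [monomial_sum_one]
  exact Finset.prod_congr rfl fun i _ => X_pow_eq_monomial

/-- The exponent `Σ_i single (σ i) (m i)` evaluated at `σ k` is `m k`. -/
theorem sum_single_perm_apply {r : ℕ} (σ : Equiv.Perm (Fin r)) (m : Fin r → ℕ) (k : Fin r) :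
    (∑ i : Fin r, Finsupp.single (σ i) (m i) : Fin r →₀ ℕ) (σ k) = m k := by
  rw [Finsupp.coe_finsetSum, Finset.sum_apply]
  simp_rw [Finsupp.single_apply, EmbeddingLike.apply_eq_iff_eq]
  rw [Finset.sum_ite_eq' Finset.univ k]
  simp

/-- **A generalized Vandermonde in distinct indeterminates is nonzero**: for an injective exponent vector
`m : Fin r → ℕ` the matrix `[X_i^(m j)]_{i,j}` over `MvPolynomial (Fin r) R` (`R` nontrivial) has nonzero
determinant — the coefficient of the monomial `∏_i X_i^(m i)` is `1` (only the identity permutation produces it). -/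
theorem det_X_pow_ne_zero {R : Type*} [CommRing R] [Nontrivial R] {r : ℕ} (m : Fin r → ℕ)
    (hm : Function.Injective m) :
    (Matrix.of fun i j : Fin r => (X i : MvPolynomial (Fin r) R) ^ m j).det ≠ 0 := by
  classical
  intro h0
  have hc := congrArg (coeff (∑ i : Fin r, Finsupp.single ((1 : Equiv.Perm (Fin r)) i) (m i))) h0
  rw [Matrix.det_apply', coeff_sum, coeff_zero] at hc
  -- each permutation contributes the monomial `Σ_i single (σ i) (m i)`
  have hterm : ∀ σ : Equiv.Perm (Fin r),
      coeff (∑ i : Fin r, Finsupp.single ((1 : Equiv.Perm (Fin r)) i) (m i))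
        ((Equiv.Perm.sign σ : MvPolynomial (Fin r) R) *
        ∏ i : Fin r, (Matrix.of fun i j : Fin r => (X i : MvPolynomial (Fin r) R) ^ m j) (σ i) i) =
      if σ = 1 then 1 else 0 := by
    intro σ
    have hprod : (∏ i : Fin r, (Matrix.of fun i j : Fin r => (X i : MvPolynomial (Fin r) R) ^ m j) (σ i) i) =
        monomial (∑ i : Fin r, Finsupp.single (σ i) (m i)) 1 := by
      simp_rw [Matrix.of_apply]
      exact prod_X_pow_eq_monomial' σ m
    rw [hprod]
    have hsign : (Equiv.Perm.sign σ : MvPolynomial (Fin r) R) = C ((Equiv.Perm.sign σ : ℤ) : R) := by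
      rcases Int.units_eq_one_or (Equiv.Perm.sign σ) with h1 | h1 <;> simp [h1]
    rw [hsign, C_mul_monomial, mul_one, coeff_monomial]
    by_cases hσ : σ = 1
    · subst hσ
      rw [if_pos rfl, if_pos rfl]
      simp
    · rw [if_neg, if_neg hσ]
      intro heq
      apply hσ
      refine Equiv.ext fun k => ?_
      have h1 := sum_single_perm_apply σ m k
      have h2 := sum_single_perm_apply (1 : Equiv.Perm (Fin r)) m (σ k)
      rw [heq] at h1
      -- `h1 : (Σ_i single i (m i)) (σ k) = m k`, `h2 : … (σ k) = m (σ k)`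
      have h12 : m (σ k) = m k := h2.symm.trans h1
      exact hm h12
  simp_rw [hterm] at hc
  rw [Finset.sum_ite_eq' Finset.univ (1 : Equiv.Perm (Fin r))] at hc
  simp at hc

/-! ## 4. The base cases `e = 0, 1` of F2 -/

/-- The binary weight of `W` is the value of its bit-vector under `finFunctionFinEquiv`. -/
theorem bin_eq_finFunctionFinEquiv (W : Finset (Fin h)) :
    ∑ c ∈ W, 2 ^ (c : ℕ) =
      ((finFunctionFinEquiv fun c : Fin h => if c ∈ W then (1 : Fin 2) else 0 : Fin (2 ^ h)) : ℕ) := by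
  rw [finFunctionFinEquiv_apply]
  have : ∀ c : Fin h, (((if c ∈ W then (1 : Fin 2) else 0 : Fin 2) : ℕ) * 2 ^ (c : ℕ)) =
      if c ∈ W then 2 ^ (c : ℕ) else 0 := by
    intro c
    split_ifs <;> simp
  simp_rw [this]
  rw [← Finset.sum_filter, Finset.filter_mem_eq_inter, Finset.univ_inter]

/-- Binary weights of distinct subsets are distinct. -/
theorem bin_injective : Function.Injective fun W : Finset (Fin h) => ∑ c ∈ W, 2 ^ (c : ℕ) := by
  intro W W' hWW'
  have h1 : (finFunctionFinEquiv fun c : Fin h => if c ∈ W then (1 : Fin 2) else 0 : Fin (2 ^ h)) =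
      finFunctionFinEquiv fun c : Fin h => if c ∈ W' then (1 : Fin 2) else 0 := by
    apply Fin.ext
    rw [← bin_eq_finFunctionFinEquiv, ← bin_eq_finFunctionFinEquiv]
    exact hWW'
  have h2 := finFunctionFinEquiv.injective h1
  ext c
  have h3 := congrFun h2 c
  by_cases hc : c ∈ W <;> by_cases hc' : c ∈ W' <;> simp_all

/-- **F2(h, 0)**: the ball `B([h], 0) = {∅}` has at most one row, whose node `Y_none` is nonzero. -/
theorem mooreBallNonsingular_zero : MooreBallNonsingular h 0 := by
  classical
  intro r u w hu hw hsmall hall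
  have hue : ∀ i, u i = ∅ := fun i => Finset.card_eq_zero.mp (Nat.le_zero.mp (hsmall i))
  have hr : r ≤ 1 := by
    by_contra hr1
    have h01 : (⟨0, by omega⟩ : Fin r) = ⟨1, by omega⟩ := hu ((hue _).trans (hue _).symm)
    exact absurd (congrArg Fin.val h01) (by simp)
  interval_cases r
  · simp [Matrix.det_isEmpty]
  · rw [Matrix.det_fin_one, Matrix.of_apply]
    exact pow_ne_zero _ (eta_ne_zero _)

/-- **F2(h, 1)**: the nodes of the rows `∅`, `{a}` are `Y_none`, `Y_none + Y_(some a)`; the substitution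
`Y_none ↦ Z_{i_∅}`, `Y_(some a) ↦ Z_{i_a} + Z_{i_∅}` (characteristic `2`) maps `η_{u i} ↦ Z_i`, so the image of
the matrix is the generalized Vandermonde `[Z_i^{bin (w j)}]` in distinct indeterminates with distinct exponents,
nonzero by `det_X_pow_ne_zero`. -/
theorem mooreBallNonsingular_one : MooreBallNonsingular h 1 := by
  classical
  intro r u w hu hw hsmall hall
  -- the row indices of `∅` and of the singletons
  obtain ⟨i₀, hi₀⟩ := hall ∅ (by simp)
  have hsing : ∀ a : Fin h, ∃ i, u i = {a} := fun a => hall {a} (by simp)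
  choose ι hι using hsing
  -- characteristic two
  have h2 : (2 : MvPolynomial (Fin r) (ZMod 2)) = 0 := by
    have := CharP.cast_eq_zero (MvPolynomial (Fin r) (ZMod 2)) 2
    simpa using this
  -- the substitution
  let g : Option (Fin h) → MvPolynomial (Fin r) (ZMod 2) :=
    fun o => Option.elim o (X i₀) fun a => X (ι a) + X i₀
  -- every row is `∅` or a singleton, and its node maps to the corresponding indeterminate
  have hnode : ∀ i, aeval g (X none + ∑ a ∈ u i, X (some a) :
      MvPolynomial (Option (Fin h)) (ZMod 2)) = X i := by
    intro i
    rcases (u i).eq_empty_or_nonempty with h0 | hne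
    · -- `u i = ∅`
      have hi : i = i₀ := hu (h0.trans hi₀.symm)
      rw [h0, Finset.sum_empty, add_zero, aeval_X, hi]
      rfl
    · -- `u i = {a}`
      obtain ⟨a, h1⟩ := Finset.card_eq_one.mp (le_antisymm (hsmall i) (Finset.card_pos.mpr hne))
      have hi : i = ι a := hu (h1.trans (hι a).symm)
      rw [h1, Finset.sum_singleton, map_add, aeval_X, aeval_X, hi]
      show (X i₀ : MvPolynomial (Fin r) (ZMod 2)) + (X (ι a) + X i₀) = X (ι a)
      rw [add_comm (X (ι a)) (X i₀), ← add_assoc, ← two_mul, h2, zero_mul, zero_add]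
  -- the image of the matrix is the generalized Vandermonde in the indeterminates `X i`
  have hmat : (aeval g).toRingHom.mapMatrix (Matrix.of fun i j : Fin r =>
      ((X none + ∑ a ∈ u i, X (some a) : MvPolynomial (Option (Fin h)) (ZMod 2))) ^
        (∑ c ∈ w j, 2 ^ (c : ℕ))) =
      Matrix.of fun i j : Fin r => (X i : MvPolynomial (Fin r) (ZMod 2)) ^ (∑ c ∈ w j, 2 ^ (c : ℕ)) := by
    refine Matrix.ext fun i j => ?_
    rw [RingHom.mapMatrix_apply, Matrix.map_apply, Matrix.of_apply, Matrix.of_apply, AlgHom.toRingHom_eq_coe,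
      RingHom.coe_coe, map_pow, hnode]
  intro h0
  apply det_X_pow_ne_zero (R := ZMod 2) (fun j : Fin r => ∑ c ∈ w j, 2 ^ (c : ℕ))
    (bin_injective.comp hw)
  rw [← hmat, ← RingHom.map_det, h0, map_zero]

/-- **F2(h, e) for `e ≤ 1`.** -/
theorem mooreBallNonsingular_of_le_one {e : ℕ} (he : e ≤ 1) : MooreBallNonsingular h e := by
  interval_cases e
  · exact mooreBallNonsingular_zero
  · exact mooreBallNonsingular_one

/-- **T1(h,1) again** (third proof, through F2): rows = the radius-`1` ball `{∅} ∪ singletons` in any order ×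
ANY `h+1` distinct columns — a numeric additive table with nonzero determinant exists. -/
theorem ballRowsUniversal_one' (r : ℕ) (u w : Fin r → Finset (Fin h)) (hu : Function.Injective u)
    (hw : Function.Injective w) (hsmall : ∀ i, (u i).card ≤ 1)
    (hall : ∀ S : Finset (Fin h), S.card ≤ 1 → ∃ i, u i = S) :
    ∃ (ω₀ : Fin h → ℂ) (ω : Fin h → Fin h → ℂ),
      (Matrix.of fun i j : Fin r => ∏ c ∈ w j, (ω₀ c + ∑ a ∈ u i, ω a c)).det ≠ 0 :=
  ballRowsUniversal_of_moore mooreBallNonsingular_one r u w hu hw hsmall hall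

/-! ## 5. The characteristic-`p` version of the predicate and its arrows (appended 2026-08-27, same seat) -/

/-- **Predicate F_p(h, e)** (characteristic-`p` Moore table; `MooreBallNonsingular = ` the case `p = 2`): for every
layout whose rows run through the ball `B([h], e)` and every injective column family, the generalized Vandermonde
`[η_{u i}^{Σ_{c ∈ w j} p^c}]` is nonzero in `𝔽_p[Y]`. NOT asserted; conjecture F_* of the seat memo says that for
every ball layout SOME prime `p` certifies it (kit j281989: the `p = 2` failures at `(5,2)` are `p = 3` successes). -/
@[conjecture] def MooreBallNonsingularChar (p h e : ℕ) : Prop :=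
  ∀ (r : ℕ) (u w : Fin r → Finset (Fin h)), Function.Injective u → Function.Injective w →
    (∀ i, (u i).card ≤ e) → (∀ S : Finset (Fin h), S.card ≤ e → ∃ i, u i = S) →
    (Matrix.of fun i j : Fin r =>
      ((X none + ∑ a ∈ u i, X (some a) : MvPolynomial (Option (Fin h)) (ZMod p))) ^
        (∑ c ∈ w j, p ^ (c : ℕ))).det ≠ 0

/-- `MooreBallNonsingularChar 2 = MooreBallNonsingular`. -/
theorem mooreBallNonsingularChar_two (h e : ℕ) : MooreBallNonsingularChar 2 h e ↔ MooreBallNonsingular h e :=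
  Iff.rfl

/-- **F_p(h,e) ⇒ T1(h,e)** for any prime `p` (through `exists_table_of_frobenius_char`). -/
theorem ballRowsUniversal_of_moore_char {p e : ℕ} [Fact p.Prime] (hF : MooreBallNonsingularChar p h e)
    (r : ℕ) (u w : Fin r → Finset (Fin h)) (hu : Function.Injective u) (hw : Function.Injective w)
    (hsmall : ∀ i, (u i).card ≤ e) (hall : ∀ S : Finset (Fin h), S.card ≤ e → ∃ i, u i = S) :
    ∃ (ω₀ : Fin h → ℂ) (ω : Fin h → Fin h → ℂ),
      (Matrix.of fun i j : Fin r => ∏ c ∈ w j, (ω₀ c + ∑ a ∈ u i, ω a c)).det ≠ 0 :=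
  exists_table_of_frobenius_char p u w (hF r u w hu hw hsmall hall)

/-- **LAYOUT-WISE form of F_*  ⇒ T1(h,e)**: it suffices that for each ball-row layout SOME prime certifies it. -/
theorem ballRowsUniversal_of_moore_some_prime {e : ℕ}
    (hF : ∀ (r : ℕ) (u w : Fin r → Finset (Fin h)), Function.Injective u → Function.Injective w →
      (∀ i, (u i).card ≤ e) → (∀ S : Finset (Fin h), S.card ≤ e → ∃ i, u i = S) →
      ∃ p : ℕ, p.Prime ∧ (Matrix.of fun i j : Fin r =>
        ((X none + ∑ a ∈ u i, X (some a) : MvPolynomial (Option (Fin h)) (ZMod p))) ^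
          (∑ c ∈ w j, p ^ (c : ℕ))).det ≠ 0)
    (r : ℕ) (u w : Fin r → Finset (Fin h)) (hu : Function.Injective u) (hw : Function.Injective w)
    (hsmall : ∀ i, (u i).card ≤ e) (hall : ∀ S : Finset (Fin h), S.card ≤ e → ∃ i, u i = S) :
    ∃ (ω₀ : Fin h → ℂ) (ω : Fin h → Fin h → ℂ),
      (Matrix.of fun i j : Fin r => ∏ c ∈ w j, (ω₀ c + ∑ a ∈ u i, ω a c)).det ≠ 0 := by
  obtain ⟨p, hp, hdet⟩ := hF r u w hu hw hsmall hall
  haveI : Fact p.Prime := ⟨hp⟩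
  exact exists_table_of_frobenius_char p u w hdet

/-- **F_p(h,e) ⇒ «BALL ROWS × ANY COLUMNS»** for any prime `p` (`h ≥ 2`, `SmallCircuits ℂ (h+h) 5`). -/
theorem partitionMinor_hit_ballRows_of_moore_char {p e : ℕ} [Fact p.Prime] (hh : 2 ≤ h)
    (hF : MooreBallNonsingularChar p h e)
    {r : ℕ} (u w : Fin r → Finset (Fin h)) (hu : Function.Injective u) (hw : Function.Injective w)
    (hsmall : ∀ i, (u i).card ≤ e) (hall : ∀ S : Finset (Fin h), S.card ≤ e → ∃ i, u i = S) :
    ∃ f ∈ SmallCircuits ℂ (h + h) 5,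
      (Matrix.of fun i j : Fin r => MvPolynomial.coeff
        (∑ a ∈ u i, Finsupp.single (Fin.castAdd h a) 1 +
          ∑ c ∈ w j, Finsupp.single (Fin.natAdd h c) 1) f).det ≠ 0 :=
  AdditiveDoor.partitionMinor_hit_ballRows_of_universal h e hh
    (fun r u w hu hw hs ha => ballRowsUniversal_of_moore_char hF r u w hu hw hs ha) u w hu hw hsmall hall

/-- **F_p(h,e) ⇒ «ANY ROWS × BALL COLUMNS»** for any prime `p`. -/
theorem partitionMinor_hit_ballColumns_of_moore_char {p e : ℕ} [Fact p.Prime] (hh : 2 ≤ h)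
    (hF : MooreBallNonsingularChar p h e)
    {r : ℕ} (u w : Fin r → Finset (Fin h)) (hu : Function.Injective u) (hw : Function.Injective w)
    (hsmall : ∀ j, (w j).card ≤ e) (hall : ∀ S : Finset (Fin h), S.card ≤ e → ∃ j, w j = S) :
    ∃ f ∈ SmallCircuits ℂ (h + h) 5,
      (Matrix.of fun i j : Fin r => MvPolynomial.coeff
        (∑ a ∈ u i, Finsupp.single (Fin.castAdd h a) 1 +
          ∑ c ∈ w j, Finsupp.single (Fin.natAdd h c) 1) f).det ≠ 0 :=
  AdditiveDoor.partitionMinor_hit_ballColumns_of_universal h e hh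
    (fun r u w hu hw hs ha => ballRowsUniversal_of_moore_char hF r u w hu hw hs ha) u w hu hw hsmall hall

end

end Summit.ValiantsHypothesis.ValiantsHypothesis.Theorems.BarrierLever.FrobeniusDoor
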